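import Summits.CriticalPhenomena.PercolationContinuityZ3.Theorems.Transplant.SiteKNConj4AllWeights
import Summits.CriticalPhenomena.PercolationContinuityZ3.Theorems.PercNearOneGluingNoHeavyLowerTailKNUniversalGluingCoefficients
import Literature.Barriers.PneNP.TSPExtensionComplexityFarkas
import HarnessLib

/-!
# SITE percolation: UNIVERSAL gluing coefficients and Kozma–Nitzan's QUESTION 5 for the site model — one probability vector on the relay set
# serves every increasing cluster event (site twin of `Theorems/PercNearOneGluingNoHeavyLowerTailKNUniversalGluingCoefficients.lean`, prim-ineq-gen-7;
# lane `prim-bschramm` C1a, prover `prim-hp-8` gen 17)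

builds on p205010 (kernel theorem, internal audit signed; external expert review pending).

With the SITE Conjecture 4 at all vertex weights (`SitePreFKG.siteKN_conj4`, p216750) the bond argument is model-free: the finite zero-sum game
(rows `a ∈ A`, columns the up-sets `𝒰` of vertex sets, payoff `P(C_o ∈ 𝒰; o↔A) − P(C_a ∈ 𝒰; o↔A)`) has value `≥ 0` because every mixed column strategy
is a monotone cluster functional for which site Conjecture 4 supplies a good row; LP duality is the tree's conic Farkas lemma
(`Literature.Barriers.PneNP.farkas`).  Results (OURS, site model, convention A, every finite graph, EVERY vertex-weight vector in `[0,1]^V`):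
* `SiteUniversalGluing.universal_upset_coefficients` — `∃ c ≥ 0, Σ_{a∈A} c_a = 1`, with `Σ_a c_a · P(C_a ∈ 𝒰, o ↔ A) ≤ P(C_o ∈ 𝒰, o ↔ A)` for EVERY up-set `𝒰`;
* `SiteUniversalGluing.kn_question5_of_universal`, **`SiteUniversalGluing.siteKN_question5`** — the site form of KN's Question 5 / display (38):
  target-independent `c` with `Σ_a c_a · P(o ↔ A, a ↔ b) ≤ P(o ↔ b)` for every `b`;
* `SiteUniversalGluing.universal_coefficients` — the same `c` serves EVERY monotone cluster property `F` (layer-cake):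
  `Σ_a c_a · E[F(C_a); o ↔ A] ≤ E[F(C_o); o ↔ A]`.
Support file (`--supports stmt-CriticalPhenomena-4575 --as helper`); no definitions, no named facts, no sorries.
[cite: KozmaNitzan2024, Conj. 4 and Question 5 (p. 32), display (38)] [cite: FioriniEtAl2015, Lemma 2 (Farkas)]
-/

noncomputable section

namespace Summit.CriticalPhenomena.PercolationContinuityZ3.Theorems.Transplant

namespace SiteUniversalGluing

open MeasureTheory Set Literature.Probability.LatticeModels Literature.Probability.Percolation
open Summit.CriticalPhenomena.PercolationContinuityZ3.Theorems.SiteTransplant (siteConn mem_siteConn)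
open Summit.CriticalPhenomena.PercolationContinuityZ3.Theorems.UniversalGluing (UpSet mixture_mono)
open SiteGen (mem_siteConn_iff_mem_siteCluster)
open scoped Classical

variable {n : ℕ} {Γ : SimpleGraph (Fin n)}

/-- The set integral of the indicator (value one) of an event is the measure of the intersection (site configurations). [folklore] -/
theorem setIntegral_indicator_one_eq (μ : Measure (Set (Fin n))) [IsFiniteMeasure μ] (D A : Set (Set (Fin n))) :
    ∫ ω in D, A.indicator (1 : Set (Fin n) → ℝ) ω ∂μ = μ.real (D ∩ A) := by
  rw [setIntegral_indicator (MeasurableSet.of_discrete)]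
  simp only [Pi.one_apply, setIntegral_const, smul_eq_mul, mul_one]

/-- `E[Σ_𝒰 λ_𝒰 1{C_x ∈ 𝒰}; W] = Σ_𝒰 λ_𝒰 · μ(W ∩ {C_x ∈ 𝒰})` (site clusters). [folklore] -/
theorem setIntegral_mixture (q : Fin n → unitInterval) (W : Set (Set (Fin n))) (lam : UpSet n → ℝ) (x : Fin n) :
    ∫ ω in W, (∑ U, lam U * (if siteCluster Γ ω x ∈ U.1 then (1 : ℝ) else 0)) ∂(prodBernoulli q) =
      ∑ U, lam U * (prodBernoulli q).real (W ∩ {ω | siteCluster Γ ω x ∈ U.1}) := by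
  set μ := prodBernoulli q with hμ
  have hint : ∀ (g : Set (Fin n) → ℝ), Integrable g (μ.restrict W) := fun g => Integrable.of_finite
  rw [integral_finsetSum _ fun U _ => hint _]
  refine Finset.sum_congr rfl fun U _ => ?_
  rw [integral_const_mul]
  congr 1
  have hind : (fun ω : Set (Fin n) => (if siteCluster Γ ω x ∈ U.1 then (1 : ℝ) else 0)) =
      ({ω : Set (Fin n) | siteCluster Γ ω x ∈ U.1} : Set (Set (Fin n))).indicator 1 := by
    funext ω
    by_cases h : ω ∈ ({ω : Set (Fin n) | siteCluster Γ ω x ∈ U.1} : Set (Set (Fin n)))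
    · rw [indicator_of_mem h, Pi.one_apply, if_pos (show siteCluster Γ ω x ∈ U.1 from h)]
    · rw [indicator_of_notMem h, if_neg (show siteCluster Γ ω x ∉ U.1 from h)]
  rw [hind, setIntegral_indicator_one_eq]

variable (Γ)

/-- **SITE UNIVERSAL GLUING COEFFICIENTS** (OURS).  On every finite graph with any vertex-weight vector, for every relay set `A ≠ ∅` and every source
`o` there is a probability vector `c` on `A` — the same for all events — with `Σ_{a∈A} c_a · P(C_a ∈ 𝒰, o ↔ A) ≤ P(C_o ∈ 𝒰, o ↔ A)` for EVERY
increasing family `𝒰` of vertex sets (site clusters, convention A).  LP duality over the finite game `A × {up-sets}`, fed by `SitePreFKG.siteKN_conj4`.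
[cite: KozmaNitzan2024, Conj. 4 and Question 5 (p. 32)] [cite: FioriniEtAl2015, Lemma 2 (Farkas)] -/
theorem universal_upset_coefficients (q : Fin n → unitInterval) (A : Finset (Fin n)) (o : Fin n) (hA : A.Nonempty) :
    ∃ c : Fin n → ℝ, (∀ a, 0 ≤ c a) ∧ ∑ a ∈ A, c a = 1 ∧
      ∀ 𝒰 : Set (Set (Fin n)), IsUpperSet 𝒰 →
        ∑ a ∈ A, c a * (prodBernoulli q).real ({ω | siteCluster Γ ω a ∈ 𝒰} ∩ ⋃ a' ∈ A, siteConn Γ o a') ≤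
          (prodBernoulli q).real ({ω | siteCluster Γ ω o ∈ 𝒰} ∩ ⋃ a' ∈ A, siteConn Γ o a') := by
  set μ := prodBernoulli q with hμ
  set W : Set (Set (Fin n)) := ⋃ a' ∈ A, siteConn Γ o a' with hW
  set K : Fin n → UpSet n → ℝ := fun a U => μ.real ({ω | siteCluster Γ ω a ∈ U.1} ∩ W) with hK
  set R : UpSet n → ℝ := fun U => μ.real ({ω | siteCluster Γ ω o ∈ U.1} ∩ W) with hR
  let gen : (↥A ⊕ UpSet n) → (UpSet n ⊕ Unit) → ℝ := fun g =>
    match g with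
    | Sum.inl a => Sum.elim (fun U => K a U) (fun _ => 1)
    | Sum.inr U₀ => Sum.elim (Pi.single U₀ 1) (fun _ => 0)
  let tgt : (UpSet n ⊕ Unit) → ℝ := Sum.elim R (fun _ => 1)
  rcases Literature.Barriers.PneNP.farkas gen tgt with ⟨lam, hlam, hfeas⟩ | ⟨y, hy, hty⟩
  · refine ⟨fun a => if h : a ∈ A then lam (Sum.inl ⟨a, h⟩) else 0, fun a => ?_, ?_, fun 𝒰 h𝒰 => ?_⟩
    · by_cases h : a ∈ A
      · simp only [h, dif_pos]; exact hlam _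
      · simp only [h, dif_neg, not_false_eq_true, le_refl]
    · have h1 := hfeas (Sum.inr ())
      simp only [tgt, gen, Sum.elim_inr, Fintype.sum_sum_type, mul_one, mul_zero, Finset.sum_const_zero, add_zero] at h1
      rw [h1, ← Finset.sum_coe_sort A]
      refine Finset.sum_congr rfl fun a _ => ?_
      simp only [a.2, dif_pos]
    · set U : UpSet n := ⟨𝒰, h𝒰⟩ with hU
      have hb := hfeas (Sum.inl U)
      simp only [tgt, gen, Sum.elim_inl, Fintype.sum_sum_type] at hb
      have hslack : ∑ U₀ : UpSet n, lam (Sum.inr U₀) * (Pi.single U₀ (1 : ℝ) : UpSet n → ℝ) U = lam (Sum.inr U) := by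
        rw [Finset.sum_eq_single U]
        · simp
        · intro U₀ _ hU₀; simp [Ne.symm hU₀]
        · intro h; exact absurd (Finset.mem_univ U) h
      rw [hslack] at hb
      have hrel : ∑ a ∈ A, (if h : a ∈ A then lam (Sum.inl ⟨a, h⟩) else 0) * μ.real ({ω | siteCluster Γ ω a ∈ 𝒰} ∩ W) =
          ∑ a : ↥A, lam (Sum.inl a) * K a U := by
        rw [← Finset.sum_coe_sort A]
        refine Finset.sum_congr rfl fun a _ => ?_
        simp only [a.2, dif_pos, hK]
        rfl
      show ∑ a ∈ A, (if h : a ∈ A then lam (Sum.inl ⟨a, h⟩) else 0) * μ.real ({ω | siteCluster Γ ω a ∈ 𝒰} ∩ W) ≤ R U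
      rw [hrel, hb]
      linarith [hlam (Sum.inr U)]
  · exfalso
    set lamb : UpSet n → ℝ := fun U => y (Sum.inl U) with hlamb
    set t : ℝ := y (Sum.inr ()) with ht
    have hdot : ∀ v : (UpSet n ⊕ Unit) → ℝ, dotProduct v y = ∑ U, v (Sum.inl U) * lamb U + v (Sum.inr ()) * t := by
      intro v
      simp only [dotProduct, Fintype.sum_sum_type, Finset.univ_unique, PUnit.default_eq_unit, Finset.sum_singleton, hlamb, ht]
    have hlamb0 : ∀ U, 0 ≤ lamb U := by
      intro U
      have h := hy (Sum.inr U)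
      rw [hdot] at h
      simp only [gen, Sum.elim_inl, Sum.elim_inr, zero_mul, add_zero] at h
      rw [Finset.sum_eq_single U] at h
      · simpa using h
      · intro U₀ _ hU₀; simp [hU₀]
      · intro h'; exact absurd (Finset.mem_univ U) h'
    have hrelay : ∀ a : ↥A, 0 ≤ ∑ U, K a U * lamb U + t := by
      intro a
      have h := hy (Sum.inl a)
      rw [hdot] at h
      simpa [gen] using h
    have htgt : ∑ U, R U * lamb U + t < 0 := by
      have h := hty
      rw [hdot] at h
      simpa [tgt] using h
    obtain ⟨a, haA, hle⟩ := SitePreFKG.siteKN_conj4 Γ q A o (fun S => ∑ U, lamb U * (if S ∈ U.1 then (1 : ℝ) else 0))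
      (mixture_mono lamb hlamb0) hA
    rw [setIntegral_mixture q W lamb a, setIntegral_mixture q W lamb o] at hle
    have hKa : ∑ U, lamb U * μ.real (W ∩ {ω | siteCluster Γ ω a ∈ U.1}) = ∑ U, K a U * lamb U :=
      Finset.sum_congr rfl fun U _ => by rw [hK, inter_comm, mul_comm]
    have hRo : ∑ U, lamb U * μ.real (W ∩ {ω | siteCluster Γ ω o ∈ U.1}) = ∑ U, R U * lamb U :=
      Finset.sum_congr rfl fun U _ => by rw [hR, inter_comm, mul_comm]
    rw [hKa, hRo] at hle
    linarith [hrelay ⟨a, haA⟩, htgt, hle]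

/-- **Site Question 5 from the universal coefficients**: the up-set `{S ∋ b}` gives `Σ_a c_a P(a ↔ b, o ↔ A) ≤ P(o ↔ b, o ↔ A)` for every `b`, with the
SAME `c` (which also serves every other increasing cluster event). [cite: KozmaNitzan2024, Question 5 (p. 32)] -/
theorem kn_question5_of_universal (q : Fin n → unitInterval) (A : Finset (Fin n)) (o : Fin n) (hA : A.Nonempty) :
    ∃ c : Fin n → ℝ, (∀ a, 0 ≤ c a) ∧ ∑ a ∈ A, c a = 1 ∧
      (∀ 𝒰 : Set (Set (Fin n)), IsUpperSet 𝒰 →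
        ∑ a ∈ A, c a * (prodBernoulli q).real ({ω | siteCluster Γ ω a ∈ 𝒰} ∩ ⋃ a' ∈ A, siteConn Γ o a') ≤
          (prodBernoulli q).real ({ω | siteCluster Γ ω o ∈ 𝒰} ∩ ⋃ a' ∈ A, siteConn Γ o a')) ∧
      ∀ b : Fin n, ∑ a ∈ A, c a * (prodBernoulli q).real (siteConn Γ a b ∩ ⋃ a' ∈ A, siteConn Γ o a') ≤
        (prodBernoulli q).real (siteConn Γ o b ∩ ⋃ a' ∈ A, siteConn Γ o a') := by
  obtain ⟨c, hc0, hc1, hcU⟩ := universal_upset_coefficients Γ q A o hA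
  refine ⟨c, hc0, hc1, hcU, fun b => ?_⟩
  have hup : IsUpperSet ({S : Set (Fin n) | b ∈ S}) := fun S T hST hS => hST hS
  have hev : ∀ x : Fin n, ({ω : Set (Fin n) | siteCluster Γ ω x ∈ {S : Set (Fin n) | b ∈ S}}) = siteConn Γ x b := by
    intro x; ext ω; exact (mem_siteConn_iff_mem_siteCluster Γ x b ω).symm
  have h := hcU {S : Set (Fin n) | b ∈ S} hup
  simp only [hev] at h
  exact h

/-- Peeling one layer: if `F = F' + δ·1_𝒰` pointwise then `∫_W F(C_x) = ∫_W F'(C_x) + δ·μ(W ∩ {C_x ∈ 𝒰})` (site clusters). [folklore] -/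
theorem setIntegral_peel (q : Fin n → unitInterval) (W : Set (Set (Fin n))) (F F' : Set (Fin n) → ℝ) (𝒰 : Set (Set (Fin n)))
    (δ : ℝ) (hFF' : ∀ S, F S = F' S + δ * 𝒰.indicator (1 : Set (Fin n) → ℝ) S) (x : Fin n) :
    ∫ ω in W, F (siteCluster Γ ω x) ∂(prodBernoulli q) =
      ∫ ω in W, F' (siteCluster Γ ω x) ∂(prodBernoulli q) + δ * (prodBernoulli q).real (W ∩ {ω | siteCluster Γ ω x ∈ 𝒰}) := by
  set μ := prodBernoulli q with hμ
  have hint : ∀ (g : Set (Fin n) → ℝ), Integrable g (μ.restrict W) := fun g => Integrable.of_finite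
  have hfun : (fun ω : Set (Fin n) => F (siteCluster Γ ω x)) =
      fun ω => F' (siteCluster Γ ω x) + δ * 𝒰.indicator (1 : Set (Fin n) → ℝ) (siteCluster Γ ω x) := funext fun ω => hFF' _
  rw [hfun, integral_add (hint _) (hint _), integral_const_mul]
  congr 2
  have hind : (fun ω : Set (Fin n) => 𝒰.indicator (1 : Set (Fin n) → ℝ) (siteCluster Γ ω x)) =
      ({ω : Set (Fin n) | siteCluster Γ ω x ∈ 𝒰} : Set (Set (Fin n))).indicator 1 := by
    funext ω
    by_cases h : ω ∈ ({ω : Set (Fin n) | siteCluster Γ ω x ∈ 𝒰} : Set (Set (Fin n)))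
    · rw [indicator_of_mem h, Pi.one_apply, indicator_of_mem (show siteCluster Γ ω x ∈ 𝒰 from h), Pi.one_apply]
    · rw [indicator_of_notMem h, indicator_of_notMem (show siteCluster Γ ω x ∉ 𝒰 from h)]
  rw [hind, setIntegral_indicator_one_eq]

/-- **SITE UNIVERSAL GLUING COEFFICIENTS FOR EVERY MONOTONE CLUSTER PROPERTY** (site Conjecture 4 with ONE probability vector `c` on `A` serving all
monotone `F` simultaneously): `Σ_{a∈A} c_a · E[F(C_a); o ↔ A] ≤ E[F(C_o); o ↔ A]` for EVERY `F` monotone on vertex sets — layer-cake over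
`universal_upset_coefficients`. [cite: KozmaNitzan2024, Conj. 4 and Question 5 (p. 32)] -/
theorem universal_coefficients (q : Fin n → unitInterval) (A : Finset (Fin n)) (o : Fin n) (hA : A.Nonempty) :
    ∃ c : Fin n → ℝ, (∀ a, 0 ≤ c a) ∧ ∑ a ∈ A, c a = 1 ∧
      ∀ F : Set (Fin n) → ℝ, (∀ S T : Set (Fin n), S ⊆ T → F S ≤ F T) →
        ∑ a ∈ A, c a * ∫ ω in ⋃ a' ∈ A, siteConn Γ o a', F (siteCluster Γ ω a) ∂(prodBernoulli q) ≤
          ∫ ω in ⋃ a' ∈ A, siteConn Γ o a', F (siteCluster Γ ω o) ∂(prodBernoulli q) := by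
  obtain ⟨c, hc0, hc1, hcU⟩ := universal_upset_coefficients Γ q A o hA
  refine ⟨c, hc0, hc1, ?_⟩
  set μ := prodBernoulli q with hμ
  set W : Set (Set (Fin n)) := ⋃ a' ∈ A, siteConn Γ o a' with hW
  suffices h : ∀ (k : ℕ) (F : Set (Fin n) → ℝ), (∀ S T : Set (Fin n), S ⊆ T → F S ≤ F T) →
      (Finset.univ.filter fun S : Set (Fin n) => F S ≠ F ∅).card ≤ k →
      ∑ a ∈ A, c a * ∫ ω in W, F (siteCluster Γ ω a) ∂μ ≤ ∫ ω in W, F (siteCluster Γ ω o) ∂μ by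
    intro F hF; exact h _ F hF le_rfl
  intro k
  induction k with
  | zero =>
    intro F hF hk
    have hconst : ∀ S, F S = F ∅ := by
      intro S
      by_contra hS
      have hmem : S ∈ Finset.univ.filter fun S : Set (Fin n) => F S ≠ F ∅ := Finset.mem_filter.2 ⟨Finset.mem_univ _, hS⟩
      have : 0 < (Finset.univ.filter fun S : Set (Fin n) => F S ≠ F ∅).card := Finset.card_pos.2 ⟨S, hmem⟩
      omega
    have hI : ∀ x : Fin n, ∫ ω in W, F (siteCluster Γ ω x) ∂μ = μ.real W * F ∅ := by
      intro x
      simp_rw [hconst]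
      rw [setIntegral_const, smul_eq_mul]
    simp_rw [hI]
    rw [← Finset.sum_mul, hc1, one_mul]
  | succ k ih =>
    intro F hF hk
    by_cases hne : (Finset.univ.filter fun S : Set (Fin n) => F S ≠ F ∅).Nonempty
    swap
    · rw [Finset.not_nonempty_iff_eq_empty] at hne
      exact ih F hF (by rw [hne, Finset.card_empty]; exact Nat.zero_le _)
    have hbot : ∀ S, F ∅ ≤ F S := fun S => hF ∅ S (empty_subset S)
    obtain ⟨S₀, hS₀Φ, ht⟩ := Finset.exists_mem_eq_inf' hne F
    set t : ℝ := (Finset.univ.filter fun S : Set (Fin n) => F S ≠ F ∅).inf' hne F with htdef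
    have hS₀ : F S₀ ≠ F ∅ := (Finset.mem_filter.1 hS₀Φ).2
    have htle : ∀ S, F S ≠ F ∅ → t ≤ F S := fun S hS => Finset.inf'_le F (Finset.mem_filter.2 ⟨Finset.mem_univ _, hS⟩)
    have hδ : 0 < t - F ∅ := by
      rw [ht]
      rcases (hbot S₀).lt_or_eq with hlt | heq
      · linarith
      · exact absurd heq.symm hS₀
    have h𝒰up : IsUpperSet ({S : Set (Fin n) | F S ≠ F ∅}) := by
      intro S T hST hS hT
      have h1 : F S ≤ F T := hF S T hST
      have h2 := hbot S
      exact hS (le_antisymm (le_of_le_of_eq h1 hT) h2)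
    have hF'mono : ∀ S T : Set (Fin n), S ⊆ T → max (F S - (t - F ∅)) (F ∅) ≤ max (F T - (t - F ∅)) (F ∅) :=
      fun S T hST => max_le_max (sub_le_sub_right (hF S T hST) _) le_rfl
    have hF'empty : max (F ∅ - (t - F ∅)) (F ∅) = F ∅ := max_eq_right (by linarith)
    have hF'val : ∀ S, F S ≠ F ∅ → max (F S - (t - F ∅)) (F ∅) = F S - (t - F ∅) :=
      fun S hS => max_eq_left (by linarith [htle S hS])
    have hFF' : ∀ S, F S = max (F S - (t - F ∅)) (F ∅) + (t - F ∅) * ({S : Set (Fin n) | F S ≠ F ∅}).indicator (1 : Set (Fin n) → ℝ) S := by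
      intro S
      by_cases hS : F S ≠ F ∅
      · rw [indicator_of_mem (show S ∈ {S : Set (Fin n) | F S ≠ F ∅} from hS), Pi.one_apply, mul_one, hF'val S hS]; ring
      · rw [indicator_of_notMem (show S ∉ {S : Set (Fin n) | F S ≠ F ∅} from hS), mul_zero, add_zero]
        push Not at hS
        rw [hS, hF'empty]
    have hcard : (Finset.univ.filter fun S : Set (Fin n) =>
        max (F S - (t - F ∅)) (F ∅) ≠ max (F ∅ - (t - F ∅)) (F ∅)).card ≤ k := by
      have hsub : (Finset.univ.filter fun S : Set (Fin n) => max (F S - (t - F ∅)) (F ∅) ≠ max (F ∅ - (t - F ∅)) (F ∅)) ⊆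
          (Finset.univ.filter fun S : Set (Fin n) => F S ≠ F ∅).erase S₀ := by
        intro S hS
        rw [Finset.mem_filter] at hS
        have hS2 := hS.2
        rw [hF'empty] at hS2
        rw [Finset.mem_erase, Finset.mem_filter]
        refine ⟨?_, Finset.mem_univ _, ?_⟩
        · rintro rfl
          rw [hF'val S hS₀, ← ht] at hS2
          exact hS2 (by ring)
        · intro hS3
          rw [hS3, hF'empty] at hS2
          exact hS2 rfl
      have h1 := Finset.card_le_card hsub
      have h2 := Finset.card_erase_of_mem hS₀Φ
      omega
    have hih := ih (fun S => max (F S - (t - F ∅)) (F ∅)) hF'mono hcard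
    have hU := hcU {S : Set (Fin n) | F S ≠ F ∅} h𝒰up
    have hpeel : ∀ x : Fin n, ∫ ω in W, F (siteCluster Γ ω x) ∂μ =
        ∫ ω in W, max (F (siteCluster Γ ω x) - (t - F ∅)) (F ∅) ∂μ +
          (t - F ∅) * μ.real (W ∩ {ω | siteCluster Γ ω x ∈ {S : Set (Fin n) | F S ≠ F ∅}}) :=
      fun x => setIntegral_peel Γ q W F (fun S => max (F S - (t - F ∅)) (F ∅)) {S : Set (Fin n) | F S ≠ F ∅} (t - F ∅) hFF' x
    simp_rw [hpeel]
    have hsplit : ∑ a ∈ A, c a * (∫ ω in W, max (F (siteCluster Γ ω a) - (t - F ∅)) (F ∅) ∂μ +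
          (t - F ∅) * μ.real (W ∩ {ω | siteCluster Γ ω a ∈ {S : Set (Fin n) | F S ≠ F ∅}})) =
        ∑ a ∈ A, c a * ∫ ω in W, max (F (siteCluster Γ ω a) - (t - F ∅)) (F ∅) ∂μ +
          (t - F ∅) * ∑ a ∈ A, c a * μ.real ({ω | siteCluster Γ ω a ∈ {S : Set (Fin n) | F S ≠ F ∅}} ∩ W) := by
      rw [Finset.mul_sum, ← Finset.sum_add_distrib]
      refine Finset.sum_congr rfl fun a _ => ?_
      rw [inter_comm]; ring
    rw [hsplit, inter_comm]
    have := mul_le_mul_of_nonneg_left hU hδ.le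
    linarith

/-- **SITE KOZMA–NITZAN QUESTION 5, answered affirmatively for the site model, in the printed form (display (38))** (OURS): on every finite graph with
any vertex-weight vector, for every `A ≠ ∅` and every `o` there are target-independent coefficients `c_a ≥ 0`, `Σ_{a∈A} c_a = 1`, with
`Σ_{a∈A} c_a · P(o ↔ A, a ↔ b) ≤ P(o ↔ b)` for EVERY vertex `b` (site connections, convention A). [cite: KozmaNitzan2024, Question 5 and display (38) (p. 32)] -/
theorem siteKN_question5 (q : Fin n → unitInterval) (A : Finset (Fin n)) (o : Fin n) (hA : A.Nonempty) :
    ∃ c : Fin n → ℝ, (∀ a, 0 ≤ c a) ∧ ∑ a ∈ A, c a = 1 ∧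
      ∀ b : Fin n, ∑ a ∈ A, c a * (prodBernoulli q).real ((⋃ a' ∈ A, siteConn Γ o a') ∩ siteConn Γ a b) ≤
        (prodBernoulli q).real (siteConn Γ o b) := by
  obtain ⟨c, hc0, hc1, -, hcb⟩ := kn_question5_of_universal Γ q A o hA
  refine ⟨c, hc0, hc1, fun b => ?_⟩
  have hmono : (prodBernoulli q).real (siteConn Γ o b ∩ ⋃ a' ∈ A, siteConn Γ o a') ≤ (prodBernoulli q).real (siteConn Γ o b) :=
    measureReal_mono inter_subset_left
  calc ∑ a ∈ A, c a * (prodBernoulli q).real ((⋃ a' ∈ A, siteConn Γ o a') ∩ siteConn Γ a b)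
      = ∑ a ∈ A, c a * (prodBernoulli q).real (siteConn Γ a b ∩ ⋃ a' ∈ A, siteConn Γ o a') :=
        Finset.sum_congr rfl fun a _ => by rw [inter_comm]
    _ ≤ (prodBernoulli q).real (siteConn Γ o b ∩ ⋃ a' ∈ A, siteConn Γ o a') := hcb b
    _ ≤ (prodBernoulli q).real (siteConn Γ o b) := hmono

end SiteUniversalGluing

end Summit.CriticalPhenomena.PercolationContinuityZ3.Theorems.Transplant
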